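import Summits.CriticalPhenomena.PercolationContinuityZ3.Theorems.PercNearOneGluingNoHeavyLowerTailNineTypeLabelCert

/-!
# Four all-`n` packings from the LL-clash-free type families of the row `Q44`

Support file for crux `stmt-CriticalPhenomena-4575` (master-family programme; Conjecture W for the quadratic four-point row
`Q44`), seat `prim-bnk-1` gen 21; memo `run/shared/lean/prim/prim-l12/FROM-prim-bnk-1-gen21-CORE-KLEITMAN.md` §3.

Among the 18 oriented member types of `Q44` (the ten B1 sides and the eight dart pair-sides), the maximal sets free of an
"LL-clash" (`l ∨ l' ∈ AC` and `h ∧ h' = ⊥`) are twelve; every one of them is GF(2)-independent in every configuration and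
carries a nine-type label certificate (memo §3).  Eight are sub-packings of landed certificates
(`…NineTypeLabelAtlas.pack_q44WeightTwo_abDarts / _cyDarts`); the remaining four pair a crossing B1 side (`ay|bc` light
against `ab|c|y` resp. `a|b|cy`) with a `K5` side, a partner dart and a CROSS dart.  They are the families of members that
contain an `a–b` bridge with `c` on the `b`-side (resp. its images), i.e. instances of the Kleitman-at-a-core-edge
phenomenon (memo §2), and as label certificates they give, via `TwoCopyMono.pack_of_tableOK`, four packing inequalities
valid on every finite weighted graph:

* `pack_bridgeFamily_ab_ac`: `P(ay|bc)P(a|b|cy) + P(ab|c|y)P(a|b|cy) + P(ab|c|y)P(a|bcy) + P(ac|b|y)P(a|bcy) ≤ [P(ab|cy)+P(abcy)]·P(∅)`;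
* `pack_bridgeFamily_ba_by`: `P(ay|bc)P(a|b|cy) + P(ab|c|y)P(a|b|cy) + P(ab|c|y)P(acy|b) + P(a|by|c)P(acy|b) ≤ …`;
* `pack_bridgeFamily_cy_ca`: `P(ay|bc)P(ab|c|y) + P(a|b|cy)P(ab|c|y) + P(a|b|cy)P(aby|c) + P(ac|b|y)P(aby|c) ≤ …`;
* `pack_bridgeFamily_yc_yb`: `P(ay|bc)P(ab|c|y) + P(a|b|cy)P(ab|c|y) + P(a|b|cy)P(abc|y) + P(a|by|c)P(abc|y) ≤ …`.

Cells are indexed as in `FourPointAtoms.pat4`.  Pure table checks (`decide`) + `linarith`; no named facts, no sorries,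
standard axioms.
-/

namespace Summit.CriticalPhenomena.PercolationContinuityZ3.Theorems

namespace TwoCopyMono

open Finset FourPointAtoms

variable {n : ℕ}

/-- Table check for the family {L4s, H5, a>b, a>c}: (heavy, light, label) = (ay|bc, a|b|cy, 8), (ab|c|y, a|b|cy, 1),
(ab|c|y, a|bcy, 1), (ac|b|y, a|bcy, 6). [this work] -/
theorem tableOK_bridgeFamily_ab_ac :
    tableOK ({(8, 1), (6, 1), (6, 7), (5, 7)} : Finset (Fin 15 × Fin 15))
      (fun p => if p = (8, 1) then 8 else if p = (6, 1) then 1 else if p = (6, 7) then 1 else 6) := by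
  decide +kernel

/-- **Packing, all `n`** (members containing an `a–b` bridge, `c` beyond `b`):
`P(ay|bc)·P(a|b|cy) + P(ab|c|y)·P(a|b|cy) + P(ab|c|y)·P(a|bcy) + P(ac|b|y)·P(a|bcy) ≤ [P(ab|cy)+P(abcy)]·P(a|b|c|y)` on every
finite weighted graph. [this work] -/
theorem pack_bridgeFamily_ab_ac (w : Sym2 (Fin n) → unitInterval) (a b c y : Fin n) :
    cell w a b c y 8 * cell w a b c y 1 +
      cell w a b c y 6 * cell w a b c y 1 +
      cell w a b c y 6 * cell w a b c y 7 +
      cell w a b c y 5 * cell w a b c y 7 ≤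
      (cell w a b c y 11 + cell w a b c y 14) * cell w a b c y 0 := by
  have h := pack_of_tableOK _ _ tableOK_bridgeFamily_ab_ac w a b c y
  rw [Finset.sum_insert (by decide), Finset.sum_insert (by decide), Finset.sum_insert (by decide),
    Finset.sum_singleton] at h
  dsimp only at h
  linarith

/-- Table check for the family {L4s, H5, b>a, b>y}: (ay|bc, a|b|cy, 8), (ab|c|y, a|b|cy, 1), (ab|c|y, acy|b, 1),
(a|by|c, acy|b, 6). [this work] -/
theorem tableOK_bridgeFamily_ba_by :
    tableOK ({(8, 1), (6, 1), (6, 10), (2, 10)} : Finset (Fin 15 × Fin 15))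
      (fun p => if p = (8, 1) then 8 else if p = (6, 1) then 1 else if p = (6, 10) then 1 else 6) := by
  decide +kernel

/-- **Packing, all `n`**:
`P(ay|bc)·P(a|b|cy) + P(ab|c|y)·P(a|b|cy) + P(ab|c|y)·P(acy|b) + P(a|by|c)·P(acy|b) ≤ [P(ab|cy)+P(abcy)]·P(a|b|c|y)` on every
finite weighted graph. [this work] -/
theorem pack_bridgeFamily_ba_by (w : Sym2 (Fin n) → unitInterval) (a b c y : Fin n) :
    cell w a b c y 8 * cell w a b c y 1 +
      cell w a b c y 6 * cell w a b c y 1 +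
      cell w a b c y 6 * cell w a b c y 10 +
      cell w a b c y 2 * cell w a b c y 10 ≤
      (cell w a b c y 11 + cell w a b c y 14) * cell w a b c y 0 := by
  have h := pack_of_tableOK _ _ tableOK_bridgeFamily_ba_by w a b c y
  rw [Finset.sum_insert (by decide), Finset.sum_insert (by decide), Finset.sum_insert (by decide),
    Finset.sum_singleton] at h
  dsimp only at h
  linarith

/-- Table check for the family {L4, L5, c>y, c>a}: (ay|bc, ab|c|y, 8), (a|b|cy, ab|c|y, 1), (a|b|cy, aby|c, 1),
(ac|b|y, aby|c, 6). [this work] -/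
theorem tableOK_bridgeFamily_cy_ca :
    tableOK ({(8, 6), (1, 6), (1, 12), (5, 12)} : Finset (Fin 15 × Fin 15))
      (fun p => if p = (8, 6) then 8 else if p = (1, 6) then 1 else if p = (1, 12) then 1 else 6) := by
  decide +kernel

/-- **Packing, all `n`**:
`P(ay|bc)·P(ab|c|y) + P(a|b|cy)·P(ab|c|y) + P(a|b|cy)·P(aby|c) + P(ac|b|y)·P(aby|c) ≤ [P(ab|cy)+P(abcy)]·P(a|b|c|y)` on every
finite weighted graph. [this work] -/
theorem pack_bridgeFamily_cy_ca (w : Sym2 (Fin n) → unitInterval) (a b c y : Fin n) :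
    cell w a b c y 8 * cell w a b c y 6 +
      cell w a b c y 1 * cell w a b c y 6 +
      cell w a b c y 1 * cell w a b c y 12 +
      cell w a b c y 5 * cell w a b c y 12 ≤
      (cell w a b c y 11 + cell w a b c y 14) * cell w a b c y 0 := by
  have h := pack_of_tableOK _ _ tableOK_bridgeFamily_cy_ca w a b c y
  rw [Finset.sum_insert (by decide), Finset.sum_insert (by decide), Finset.sum_insert (by decide),
    Finset.sum_singleton] at h
  dsimp only at h
  linarith

/-- Table check for the family {L4, L5, y>c, y>b}: (ay|bc, ab|c|y, 8), (a|b|cy, ab|c|y, 1), (a|b|cy, abc|y, 1),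
(a|by|c, abc|y, 6). [this work] -/
theorem tableOK_bridgeFamily_yc_yb :
    tableOK ({(8, 6), (1, 6), (1, 13), (2, 13)} : Finset (Fin 15 × Fin 15))
      (fun p => if p = (8, 6) then 8 else if p = (1, 6) then 1 else if p = (1, 13) then 1 else 6) := by
  decide +kernel

/-- **Packing, all `n`**:
`P(ay|bc)·P(ab|c|y) + P(a|b|cy)·P(ab|c|y) + P(a|b|cy)·P(abc|y) + P(a|by|c)·P(abc|y) ≤ [P(ab|cy)+P(abcy)]·P(a|b|c|y)` on every
finite weighted graph. [this work] -/
theorem pack_bridgeFamily_yc_yb (w : Sym2 (Fin n) → unitInterval) (a b c y : Fin n) :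
    cell w a b c y 8 * cell w a b c y 6 +
      cell w a b c y 1 * cell w a b c y 6 +
      cell w a b c y 1 * cell w a b c y 13 +
      cell w a b c y 2 * cell w a b c y 13 ≤
      (cell w a b c y 11 + cell w a b c y 14) * cell w a b c y 0 := by
  have h := pack_of_tableOK _ _ tableOK_bridgeFamily_yc_yb w a b c y
  rw [Finset.sum_insert (by decide), Finset.sum_insert (by decide), Finset.sum_insert (by decide),
    Finset.sum_singleton] at h
  dsimp only at h
  linarith

end TwoCopyMono

end Summit.CriticalPhenomena.PercolationContinuityZ3.Theorems
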